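import Summits.AtomisticToContinuum.Crystallization.Theorems.OverbindingBudgetAffineCompressedCutMin
import Summits.AtomisticToContinuum.Crystallization.Theorems.OverbindingBudgetAffineCompressedCutF1

/-!
(SPLIT FOR THE 400-LINE CAP by the landing lane, hand-2 g37: this file = part 1 of 2; the sequel `…OverbindingBudgetAffineCompressedCutFirst` imports it; same namespace, all FQNs unchanged; landing-lane dedup treatment: `norm_of_mem_twoShellPattern` carries a `private` token (dedup.landed twin of `Literature.Geometry.DiscreteGeometry.norm_of_mem_twoShellPattern`), and `lennardJones_anti` / `floor_nonpos` ride in part 2 as `private` twins of `…PhononSlackCertificatesNearFarGlueR.lennardJones_le_of_le_one` / `…FluxCellKeplerSketchCoercive.iInf_energyPerParticle_nonpos`.)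
# NODE g79 «CompressedCut», ADDENDUM 2 — the FIRST (letter-free) class of the near-field law PROVED; open leaf = the affine class NS♭₂(12, 1/25)

Rider over the tree modules `…OverbindingBudgetAffineCompressedCut` (node g79: RO ⟸ KD ⟸ PS ⟸ NS ∧ FC, FC PROVED), `…CompressedCutMin`
(§6b: the economical leaf `NearFieldSlackMin 12 (1/25)` «NS♭», seam `compressedRun_of_nearFieldSlackMin` PROVED) and `…CompressedCutF1`
((F1′) the first-shell scale floor).  Route `OverbindingBudget` (Crystallization), crux `RobustDefectLimitWindows`
(stmt-AtomisticToContinuum-31280), decomp-a2c lens 4, generation 79; memo `HOME/decomp-a2c-lens-4/g79/memo/NODE-g79-CompressedCut.md` §5–§6.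

CONTENT (= §6c of the seat's node file, 18 new declarations, all PROVED, standard axioms).  The near law `NearFieldSlackAt` splits by priced
class (`NearFieldSlackFirstAt` / `NearFieldSlackSecondAt`, `nearFieldSlackAt_of_first_second`).  The FIRST class at `s₀ = 17/50` is PROVED
OUTRIGHT for every window and every affine literal (`nearFieldSlackFirstAt_record`), by packing alone: twelve kissing-point partners of the
frame (`twelve_le_card_firstShell`) at weight `≥ ½` ((F1′) `not_le_two_fifths_of_firstShell`) with `V ≥ V(53/50·nn) ≥ 0` (`lennardJones_anti`,
`lennardJones_nonneg_of_pow_le`), every other weighted partner `(2/5)·nn`-coarse and `≥ 27/20·nn` away (`le_dist_of_not_firstShell_record`), hence a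
near-shell sum `≤ (17/6)·(2nn/5)⁻⁶/6` (`sum_inv_pow_six_le_shell_three`), and `e⋆ ≤ 0` (`floor_nonpos`, the tree floor at a one-point
configuration — a constant inequality, not a second localisation); numerically `6·V(53/50·s) − (17/36)(5/2)⁶·s⁻⁶ ≥ 1 + s⁻⁶/25` for
`s⁻⁶ ≥ (50/17)⁶ ≥ 647` with margin `≈ 2.9·10⁴`.  Consequently the node's open leaf is the SECOND (affine) class ALONE:
**`NearFieldSlackMinSecond 12 (1/25)`** («NS♭₂»: at every sound `(12, 10⁻⁴, 10⁻³)`-affinely deep site with `nn < 17/20`, on every window,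
`∃ c > 0, e⋆ + c + nn⁻⁶/25 ≤ nearLoad 12`), with `nearFieldSlackMin_of_second : NS♭₂ → NS♭`, `nearFieldSlackMinSecond_of_min : NS♭ → NS♭₂`
and **`compressedRun_of_nearFieldSlackMinSecond : NearFieldSlackMinSecond 12 (1/25) → CompressedRun`**.  TAGS: NS♭₂ «WEAKER than NS♭ and
than PS (their affine class verbatim) · TRUE-type (margin ≈ 0.3 at nn = 17/20) · ATTACKABLE-M (explicit short affine development with its own
constant — NOT the record's `hA : AffineChartStraightening` by name, whose constant is existential — + exact affine-lattice near sum within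
≈ 4·nn + a shell count beyond)»; NS♭₁ (first class) «PROVED».

Deps: tree only.  No `instance`, no `notation`, no new axioms; restates nothing (every node / Literature declaration is used BY NAME).
-/

namespace Summit.AtomisticToContinuum.Crystallization.Theorems.OverbindingBudgetAffineCompressedCut

open scoped BigOperators Classical
open Literature.MathematicalPhysics.StatisticalMechanics
open Literature.Geometry.DiscreteGeometry (IsChargeFree nearestDist nearestDist_nonneg nearestDist_le_dist)
open Summit.AtomisticToContinuum.Crystallization.Theorems.OverbindingBudgetMisfitRegistration (Framed Reg DeepReg)
open Summit.AtomisticToContinuum.Crystallization.Theorems.OverbindingBudgetMisfitWindowStatements (InWindow offCount)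
open Summit.AtomisticToContinuum.Crystallization.Theorems.OverbindingBudgetBalancedCensusStatements
open Summit.AtomisticToContinuum.Crystallization.Theorems.OverbindingBudgetAffineLadder
open Summit.AtomisticToContinuum.Crystallization.Theorems.OverbindingBudgetAffineLocalisation (pairSum two_mul_interactionEnergy_eq_pairSum
  pairSum_univ_left pairSum_univ_right card_mul_floor_le_half_pairSum)
open Summit.AtomisticToContinuum.Crystallization.Theorems.OverbindingBudgetAffineMesoCut
open Summit.AtomisticToContinuum.Crystallization.Theorems.OverbindingBudgetAffinePhaseCut
open Summit.AtomisticToContinuum.Crystallization.Theorems.OverbindingBudgetAffineCushionCut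
open Summit.AtomisticToContinuum.Crystallization.Theorems.OverbindingBudgetAffineTwinCut
open Summit.AtomisticToContinuum.Crystallization.Theorems.OverbindingBudgetAffineRunCut

variable {N : ℕ}
open Summit.AtomisticToContinuum.Crystallization.Theorems.OverbindingBudgetAffineCompressedCutF1 (firstShell_scale_floor
  firstShell_scale_floor_record not_le_two_fifths_of_firstShell)

/-! ## §6c  PROVED: the FIRST (letter-free) class of the near-field law at `s₀ = 17/50`, `(R, κ) = (12, 1/25)`

The near law splits by priced class (`nearFieldSlackAt_of_first_second`).  The FIRST class — sound sites with `nn_i < 17/50`, any letter, any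
affine class — is PROVED OUTRIGHT (`nearFieldSlackFirstAt_record`): at such a site `i` (scale `s = nn_i`; two-shell framed, being deeply
registered) the twelve first-shell partners (the kissing points of the frame, `twelve_le_card_firstShell`) sit at distance `≤ 53/50·s ≤ 0.3604`,
where `V ≥ V(53/50·s) ≥ 0` (`lennardJones_anti`), each at weight `≥ ½` — the FIRST-SHELL SCALE FLOOR (F1′) `nn_k ≥ 11/25·s > 2/5·s`, proved in
`…CompressedCutF1` from the exhaustive clause of `Framed` alone (`firstShell_scale_floor`) —, bad partners entering through `max V 0 ≥ V`; every other partner with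
non-zero weight has own spacing `> 2/5·s` (weight rule; `nn ≥ 17/50 > 2/5·s` for the sound unpriced) and lies `≥ 27/20·s` away (exhaustive clause:
a site within `(3/2 + g)·s` is matched to a pattern point of norm `1` or `√2`, `le_dist_of_not_firstShell`), so the pull is a NEAR-SHELL SUM
`≤ (17/6)·(2s/5)⁻⁶/6 ≈ 115.3·s⁻⁶` (`sum_inv_pow_six_le_shell_three`: shells `b ≥ 3` of thickness `η` hold `≤ 48b² + 48b + 28 ≤ 68b²` points,
`∑_{b ≥ 3} b⁻⁴ ≤ 1/24`).  With `e⋆ ≤ 0` (`floor_nonpos`) the budget `6·V(53/50·s) − 115.3·s⁻⁶ ≥ e⋆ + 1 + s⁻⁶/25` holds for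
`s⁻⁶ ≥ (50/17)⁶ ≥ 647` with margin `≈ 2.9·10⁴` (`0.2485·u² ≥ 160.8·u` against `116.05·u + 1`, `u = s⁻⁶`).  The open leaf of the node is thereby
the SECOND (affine) class ALONE: `NearFieldSlackMinSecond 12 (1/25)` («NS♭₂»; `compressedRun_of_nearFieldSlackMinSecond`). -/

open Literature.Geometry.DiscreteGeometry (le_nearestDist fccTwoShellPattern hcpTwoShellPattern one_le_dist_of_mem_fccTwoShellPattern
  one_le_dist_of_mem_hcpTwoShellPattern norm_of_mem_fccTwoShellPattern norm_of_mem_hcpTwoShellPattern fccKissingPattern hcpKissingPattern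
  fccKissingPattern_subset hcpKissingPattern_subset card_fccKissingPattern card_hcpKissingPattern norm_eq_one_of_mem_fccKissingPattern
  norm_eq_one_of_mem_hcpKissingPattern)

/-- Either two-shell pattern is `1`-separated. [Literature `one_le_dist_of_mem_fcc/hcpTwoShellPattern`] -/
private theorem one_le_dist_of_mem_twoShellPattern {P : Finset (EuclideanSpace ℝ (Fin 3))} (hP : P = fccTwoShellPattern ∨ P = hcpTwoShellPattern)
    {v w : EuclideanSpace ℝ (Fin 3)} (hv : v ∈ P) (hw : w ∈ P) (hvw : v ≠ w) : 1 ≤ dist v w := by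
  rcases hP with rfl | rfl
  · exact one_le_dist_of_mem_fccTwoShellPattern hv hw hvw
  · exact one_le_dist_of_mem_hcpTwoShellPattern hv hw hvw

/-- Points of either two-shell pattern have norm `1` or `√2`. [Literature `norm_of_mem_fcc/hcpTwoShellPattern`] -/
private theorem norm_of_mem_twoShellPattern {P : Finset (EuclideanSpace ℝ (Fin 3))} (hP : P = fccTwoShellPattern ∨ P = hcpTwoShellPattern)
    {v : EuclideanSpace ℝ (Fin 3)} (hv : v ∈ P) : ‖v‖ = 1 ∨ ‖v‖ = Real.sqrt 2 := by
  rcases hP with rfl | rfl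
  · exact norm_of_mem_fccTwoShellPattern hv
  · exact norm_of_mem_hcpTwoShellPattern hv

/-- Points of either two-shell pattern have norm `≥ 1`. [Literature `norm_of_mem_fcc/hcpTwoShellPattern`] -/
private theorem one_le_norm_of_mem_twoShellPattern {P : Finset (EuclideanSpace ℝ (Fin 3))} (hP : P = fccTwoShellPattern ∨ P = hcpTwoShellPattern)
    {v : EuclideanSpace ℝ (Fin 3)} (hv : v ∈ P) : 1 ≤ ‖v‖ := by
  have h2 : (1 : ℝ) ≤ Real.sqrt 2 := Real.one_le_sqrt.mpr (by norm_num)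
  rcases norm_of_mem_twoShellPattern hP hv with h | h <;> rw [h]
  exact h2

/-- The kissing configuration inside either two-shell pattern: `12` points of norm `1`. [Literature `fcc/hcpKissingPattern_subset`,
`card_fcc/hcpKissingPattern`, `norm_eq_one_of_mem_fcc/hcpKissingPattern`] -/
theorem exists_kissing_of_twoShellPattern {P : Finset (EuclideanSpace ℝ (Fin 3))} (hP : P = fccTwoShellPattern ∨ P = hcpTwoShellPattern) :
    ∃ K : Finset (EuclideanSpace ℝ (Fin 3)), K ⊆ P ∧ K.card = 12 ∧ ∀ v ∈ K, ‖v‖ = 1 := by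
  rcases hP with rfl | rfl
  · exact ⟨fccKissingPattern, fccKissingPattern_subset, card_fccKissingPattern, fun v hv => norm_eq_one_of_mem_fccKissingPattern hv⟩
  · exact ⟨hcpKissingPattern, hcpKissingPattern_subset, card_hcpKissingPattern, fun v hv => norm_eq_one_of_mem_hcpKissingPattern hv⟩

/-- **Twelve first-shell partners.**  At an `(ε, g)`-framed site `i` with `nn_i > 0` and `ε < 1`, at least `12` sites `k ≠ i` lie within
`(1 + ε)·nn_i` of `y i` (the sites matched to the kissing points of the frame). [this file] -/
theorem twelve_le_card_firstShell {ε g : ℝ} (hε1 : ε < 1) {y : Fin N → EuclideanSpace ℝ (Fin 3)} {i : Fin N}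
    (hi : Framed ε g y i) (hs : 0 < nearestDist y i) :
    12 ≤ (Finset.univ.filter fun k => k ≠ i ∧ dist (y i) (y k) ≤ (1 + ε) * nearestDist y i).card := by
  classical
  obtain ⟨A, P, f, hP, hf, hinj, -⟩ := hi
  obtain ⟨K, hKP, hK, hK1⟩ := exists_kissing_of_twoShellPattern hP
  set s := nearestDist y i with hs_def
  have hex : ∀ v ∈ K, ∃ k, y k = f v := fun v hv => (hf v (hKP hv)).1
  let g : EuclideanSpace ℝ (Fin 3) → Fin N := fun v => if h : ∃ k, y k = f v then h.choose else i
  have hg : ∀ v ∈ K, y (g v) = f v := fun v hv => by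
    simp only [g, dif_pos (hex v hv)]
    exact (hex v hv).choose_spec
  have hc : ∀ v ∈ K, dist (y i) (y i + s • A v) = s := fun v hv => by
    rw [dist_comm, dist_eq_norm, add_sub_cancel_left, norm_smul, Real.norm_of_nonneg hs.le, A.norm_map, hK1 v hv, mul_one]
  rw [← hK]
  refine Finset.card_le_card_of_injOn g ?_ ?_
  · intro v hv
    have hv' : v ∈ K := by simpa using hv
    have h2 := (hf v (hKP hv')).2
    have htri := dist_triangle (y i) (y i + s • A v) (f v)
    rw [hc v hv', dist_comm (y i + s • A v) (f v)] at htri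
    simp only [Finset.coe_filter, Finset.mem_univ, true_and, Set.mem_setOf_eq]
    refine ⟨fun h => ?_, ?_⟩
    · -- `g v = i` would put `y i` within `ε s < s` of `y i + s•Av`, which is at distance `s`
      have hfv : f v = y i := by rw [← hg v hv', h]
      have h3 := h2
      rw [hfv, hc v hv'] at h3
      nlinarith
    · rw [hg v hv']; linarith
  · intro v hv w hw hvw
    have hv' : v ∈ K := by simpa using hv
    have hw' : w ∈ K := by simpa using hw
    exact hinj (hKP hv') (hKP hw') (by rw [← hg v hv', ← hg w hw', hvw])

/-- **Beyond the first shell.**  At an `(ε, g)`-framed site `i`, a site `k ≠ i` farther than `(1 + ε)·nn_i` from `y i` is at least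
`min (√2 − ε) (3/2 + g)·nn_i` away (inside the exhaustive radius it is matched to a pattern point, of norm `1` — excluded — or `√2`). [this file] -/
theorem le_dist_of_not_firstShell {ε g : ℝ} {y : Fin N → EuclideanSpace ℝ (Fin 3)} {i k : Fin N} (hi : Framed ε g y i) (hki : k ≠ i)
    (hk : ¬ dist (y i) (y k) ≤ (1 + ε) * nearestDist y i) :
    min (Real.sqrt 2 - ε) (3 / 2 + g) * nearestDist y i ≤ dist (y i) (y k) := by
  obtain ⟨A, P, f, hP, hf, -, hex⟩ := hi
  set s := nearestDist y i with hs_def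
  have hnn : 0 ≤ s := nearestDist_nonneg y i
  by_cases hkn : dist (y k) (y i) ≤ (3 / 2 + g) * s
  · obtain ⟨v, hv, hfv⟩ := hex k hki hkn
    have hvk : dist (y k) (y i + s • A v) ≤ ε * s := by have h := (hf v hv).2; rwa [hfv] at h
    have hc : dist (y i + s • A v) (y i) = s * ‖v‖ := by
      rw [dist_eq_norm, add_sub_cancel_left, norm_smul, Real.norm_of_nonneg hnn, A.norm_map]
    rcases norm_of_mem_twoShellPattern hP hv with h1 | h2
    · exfalso
      apply hk
      have htri := dist_triangle (y i) (y i + s • A v) (y k)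
      rw [dist_comm (y i) (y i + s • A v), hc, h1, mul_one, dist_comm (y i + s • A v) (y k)] at htri
      linarith
    · have htri := dist_triangle (y i + s • A v) (y k) (y i)
      rw [hc, h2, dist_comm (y i + s • A v) (y k)] at htri
      have hmin : min (Real.sqrt 2 - ε) (3 / 2 + g) * s ≤ (Real.sqrt 2 - ε) * s :=
        mul_le_mul_of_nonneg_right (min_le_left _ _) hnn
      rw [dist_comm (y i) (y k)]
      nlinarith
  · push Not at hkn
    have hmin : min (Real.sqrt 2 - ε) (3 / 2 + g) * s ≤ (3 / 2 + g) * s := mul_le_mul_of_nonneg_right (min_le_right _ _) hnn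
    rw [dist_comm (y i) (y k)]
    linarith

/-- Record instance: at `(ε, g) = (3/50, 1/450)` a site `k ≠ i` beyond `53/50·nn_i` is `≥ 27/20·nn_i` away (`√2 − 3/50 ≥ 1.35`). [this file] -/
theorem le_dist_of_not_firstShell_record {y : Fin N → EuclideanSpace ℝ (Fin 3)} {i k : Fin N} (hi : Framed (3 / 50) (1 / 450) y i)
    (hki : k ≠ i) (hk : ¬ dist (y i) (y k) ≤ 53 / 50 * nearestDist y i) : 27 / 20 * nearestDist y i ≤ dist (y i) (y k) := by
  have h := le_dist_of_not_firstShell hi hki (by rwa [show (1 : ℝ) + 3 / 50 = 53 / 50 by norm_num])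
  have h2 : (141 / 100 : ℝ) ≤ Real.sqrt 2 := by
    rw [show (141 / 100 : ℝ) = Real.sqrt ((141 / 100) ^ 2) by rw [Real.sqrt_sq (by norm_num)]]
    exact Real.sqrt_le_sqrt (by norm_num)
  have h3 : (27 / 20 : ℝ) ≤ min (Real.sqrt 2 - 3 / 50) (3 / 2 + 1 / 450) := le_min (by linarith) (by norm_num)
  exact le_trans (mul_le_mul_of_nonneg_right h3 (nearestDist_nonneg y i)) h

/-- `V(r) ≥ 0` for `0 < r` with `r⁶ ≤ 1/2`. [folklore; BlancLewin2015 (3)] -/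
theorem lennardJones_nonneg_of_pow_le {r : ℝ} (hr : 0 < r) (h : r ^ 6 ≤ 1 / 2) : 0 ≤ lennardJones r := by
  unfold lennardJones
  set q := (r⁻¹) ^ 6 with hq
  have hq2 : 2 ≤ q := by
    have h' : r ^ 6 ≤ (2 : ℝ)⁻¹ := by rw [show (2 : ℝ)⁻¹ = 1 / 2 by norm_num]; exact h
    rw [hq, inv_pow]
    exact (le_inv_comm₀ (by norm_num) (by positivity)).2 h'
  have e : (r⁻¹) ^ 12 = q ^ 2 := by rw [hq, ← pow_mul]
  rw [e]
  nlinarith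


end Summit.AtomisticToContinuum.Crystallization.Theorems.OverbindingBudgetAffineCompressedCut
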